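import Mathlib
import HarnessLib
import Literature.AlgebraicGeometry.Resolution.NormalBirationalQuasiFinite
import Summits.ResolutionOfSingularities.ResolutionOfSingularities.Theorems.HomologicalConductorNoZenoQuadraticSeqReach
import Summits.ResolutionOfSingularities.ResolutionOfSingularities.Theorems.HomologicalConductorNoZenoExitDivisorReach

/-!
# Crux `NoZeno` / `NoZenoR` (stmt-16483 / -19943), line `sandwich-cluster`, stub S2 — component (b):
# the two-dimensional dichotomy «regular, or a base point» (Zariski's Main Theorem)

OURS (cell res-hironaka, seat res-L0-w44-stub-3); nothing here is a statement of the manuscript under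
review; AI-written, weaker than expert review.  `isRegularLocalRing_or_basePts_nonempty`: `R` regular
local of dimension two (`Frac R = K`, `tr.deg_k K = 2`) dominated by `O`; `T ⊇ R` a normal Noetherian
local `k`-subalgebra of `O`, essentially of finite type over `k`, dominated by `O` ⇒ `T` is regular or
`basePts R T ≠ ∅`.  Reach `T ≤ S_N` (`exists_le_quadraticSeq`), `N` minimal; `N = 0`: `T = R`; `S_N` of
dimension `≤ 1`: `S_N = O` is a DVR and `S_{N-1}` is a base point by (E)
`coe_eq_ordSet_of_isQuadraticTransformAlong_self`; else ZARISKI'S MAIN THEOREM for the local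
birational extension `T ≤ S_N` (tree `bijective_algebraMap_of_essFiniteType_of_forall_isPrime`; `S_N`
essentially of finite type over `T` by `exists_finset_presentation_of_sequence`; residue algebraicity by
`Lipman1978ValuativeQuadraticSequence.not_mem_of_residuallyTranscendental`): `T = S_N` regular, or a
prime `P ≠ 𝔪` of `S_N` over `𝔪_T` has height one and `W = (S_N)_P` (`placeOfPrime`) is a DVR
dominating `R`, `T` but not `S_N`, whence a base point by `basePts_nonempty_of_exceptional_divisor`.

References: Zariski–Samuel II App. 5 [`ZariskiSamuel1960`]; The Stacks Project, Tag 00Q9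
[`StacksProject`]; Abhyankar 1956 [`Abhyankar1956Valuations`].
-/

noncomputable section

-- single-problem summit: the doubled namespace component `ResolutionOfSingularities` is forced
set_option linter.dupNamespace false

namespace Summit.ResolutionOfSingularities.ResolutionOfSingularities.Theorems.NoZeno.SandwichCluster

open IsLocalRing Literature.AlgebraicGeometry.Resolution Polynomial
open Summit.ResolutionOfSingularities.ResolutionOfSingularities.Theorems
open Summit.ResolutionOfSingularities.ResolutionOfSingularities.Theorems.NoZeno.Birth
open Summit.ResolutionOfSingularities.ResolutionOfSingularities.Theses.HomologicalConductor

variable {k K : Type} [Field k] [Field K] [Algebra k K]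

/-! ## S2: no base point ⇒ regular -/

/-- **The two-dimensional case of S2.**  `R` regular local of dimension two (`Frac R = K`,
`tr.deg_k K = 2`) dominated by `O`; `T ⊇ R` a normal Noetherian local `k`-subalgebra of `O`,
essentially of finite type over `k`, dominated by `O`.  Then `T` is regular or has a base point over
`R`.  (Reach `T ≤ S_N`, `N` minimal; `N = 0`: `T = R`; `S_N` a DVR: base point `S_{N-1}` by (E);
else Zariski's Main Theorem for `T ≤ S_N`: `T = S_N` regular, or an exceptional prime divisor
`(S_N)_P` gives a base point by `basePts_nonempty_of_exceptional_divisor`.)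
[cite: ZariskiSamuel1960, App. 5] -/
theorem isRegularLocalRing_or_basePts_nonempty {R T : Subalgebra k K} [IsRegularLocalRing ↥R]
    [IsFractionRing ↥R K] (htr : Algebra.trdeg k K = 2) (hdimR : ringKrullDim ↥R = 2)
    (O : ValuationSubring K) (hRO : SubringDominates R.toSubring O.toSubring) (hRT : R ≤ T)
    (hTO : T.toSubring ≤ O.toSubring) (hdomT : ∀ t : K, t ∈ T → t⁻¹ ∈ O → t⁻¹ ∈ T)
    [Algebra.EssFiniteType k ↥T] [IsNoetherianRing ↥T] [IsLocalRing ↥T] [IsIntegrallyClosed ↥T] :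
    IsRegularLocalRing ↥T ∨ (basePts R T).Nonempty := by
  classical
  haveI := isDomain_of_isRegularLocalRing (↥R)
  haveI : IsFractionRing ↥T K := isFractionRing_subalgebra_of_le R T hRT
  -- the sequence
  set seq : ℕ → Subring K := quadraticSeq O R.toSubring with hseq
  have hreg0 : IsRegularLocalRing ↥(seq 0) := ‹IsRegularLocalRing ↥R›
  haveI : IsLocalRing ↥(seq 0) := hreg0.toIsLocalRing
  have hnf : ¬ IsField ↥(seq 0) := fun hF => by
    have h := ringKrullDim_eq_zero_of_isField hF
    have h' : ringKrullDim ↥R = 0 := h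
    rw [hdimR] at h'
    exact absurd h' (by norm_num)
  have hstep : ∀ i, IsQuadraticTransformAlong O (seq i) (seq (i + 1)) := fun i =>
    RuledResiduesRegularModelRuled.isQuadraticTransformAlong_quadraticSeq_of_isRegularLocalRing
      hreg0 hnf hRO i
  have hmono : Monotone seq := sequence_monotone hstep
  have hregi : ∀ i, IsRegularLocalRing ↥(seq i) := isRegularLocalRing_sequence hreg0 hstep
  have hdomO : ∀ i, SubringDominates (seq i) O.toSubring := fun i => (sequence_dominates hRO hstep i).1
  have hof : ∀ i, ∀ z : K, ∃ a ∈ seq i, ∃ b ∈ seq i, b ≠ 0 ∧ z = a / b := by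
    intro i z
    obtain ⟨a, b, hb, rfl⟩ := IsFractionRing.div_surjective (A := ↥R) z
    have hbK : (b : K) ≠ 0 := fun h => nonZeroDivisors.ne_zero hb (by exact_mod_cast h)
    exact ⟨(a : K), hmono (Nat.zero_le i) a.2, (b : K), hmono (Nat.zero_le i) b.2, hbK, rfl⟩
  -- reach, with `N` minimal
  have hex : ∃ N, T.toSubring ≤ seq N := exists_le_quadraticSeq hdimR O hRO hTO
  set N := Nat.find hex with hNdef
  have hTN : T.toSubring ≤ seq N := Nat.find_spec hex
  have hTmin : ∀ j, j < N → ¬ T.toSubring ≤ seq j := fun j hj => Nat.find_min hex hj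
  -- `N = 0`: `T = R`
  rcases Nat.eq_zero_or_pos N with hN0 | hNpos
  · left
    have hTR : T = R := by
      refine le_antisymm (fun z hz => ?_) hRT
      have := hTN hz
      rw [hN0] at this
      exact this
    rw [hTR]; exact ‹IsRegularLocalRing ↥R›
  obtain ⟨N', hN'⟩ : ∃ N', N = N' + 1 := ⟨N - 1, by omega⟩
  -- members `< N` are two-dimensional (a member of dimension `≤ 1` is `O ⊇ T`)
  have hdim2 : ∀ j, j < N → (2 : WithBot ℕ∞) ≤ ringKrullDim ↥(seq j) := by
    intro j hj
    haveI := hregi j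
    refine RuledResiduesRegularModelRuled.two_le_ringKrullDim_of_not_le_one fun hle => ?_
    have heq : seq j = O.toSubring :=
      RuledResiduesRegularModelRuled.eq_of_isRegularLocalRing_of_ringKrullDim_le_one (hregi j)
        hle (hof j) (hdomO j)
    exact hTmin j hj (heq ▸ hTO)
  by_cases hdimN : ringKrullDim ↥(seq N) ≤ 1
  · -- `S_N = O` is a DVR; base point `S_{N'}` by (E)
    right
    have hNO : seq N = O.toSubring :=
      RuledResiduesRegularModelRuled.eq_of_isRegularLocalRing_of_ringKrullDim_le_one (hregi N)
        hdimN (hof N) (hdomO N)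
    have e : ↥(seq N) ≃+* ↥O := RingEquiv.subringCongr hNO
    haveI : IsRegularLocalRing ↥(seq N) := hregi N
    haveI : IsRegularLocalRing ↥O := IsRegularLocalRing.of_ringEquiv (R := ↥(seq N)) e
    have hnfO : ¬ IsField ↥O := by
      rw [IsLocalRing.isField_iff_maximalIdeal_eq]
      intro hbot
      apply hnf
      rw [IsLocalRing.isField_iff_maximalIdeal_eq, eq_bot_iff]
      intro r hr
      by_contra hr0
      have hr0' : (r : K) ≠ 0 := fun h => hr0 (by exact_mod_cast h)
      have hrO : (⟨(r : K), hRO.1 r.2⟩ : ↥O) ∈ maximalIdeal ↥O := by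
        rw [IsLocalRing.mem_maximalIdeal, mem_nonunits_iff]
        intro hu
        have hinv : ((r : K))⁻¹ ∈ O := by
          have h := (isUnit_subring_iff_inv_mem (R := O.toSubring) ⟨(r : K), hRO.1 r.2⟩).mp hu
          exact h.2
        have hinvR : ((r : K))⁻¹ ∈ seq 0 := hRO.2 _ r.2 hinv
        exact (IsLocalRing.mem_maximalIdeal _).mp hr
          ((isUnit_subring_iff_inv_mem r).mpr ⟨hr0', hinvR⟩)
      rw [hbot, Ideal.mem_bot] at hrO
      exact hr0' (congrArg Subtype.val hrO)
    have hV : ValuationRing ↥O := inferInstance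
    haveI : IsNoetherianRing ↥O := inferInstance
    haveI : IsDiscreteValuationRing ↥O :=
      ((IsDiscreteValuationRing.TFAE ↥O hnfO).out 0 1).mpr hV
    -- the member `S_{N'}` as a `k`-subalgebra
    have hN'N : N' < N := by omega
    have hRS' : R.toSubring ≤ seq N' := hmono (Nat.zero_le N')
    let S' : Subalgebra k K :=
      { (seq N').toSubsemiring with algebraMap_mem' := fun c => hRS' (R.algebraMap_mem c) }
    have hRS'' : R ≤ S' := fun z hz => hRS' hz
    haveI hregS' : IsRegularLocalRing ↥S' := hregi N'
    haveI : IsFractionRing ↥S' K := isFractionRing_subalgebra_of_le R S' hRS''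
    have hdomS' : SubringDominates S'.toSubring O.toSubring := hdomO N'
    have hstepS' : IsQuadraticTransformAlong O S'.toSubring O.toSubring := by
      have h := hstep N'
      rw [← hN', hNO] at h
      exact h
    have hOS' : (O : Set K) = ordSet S' :=
      coe_eq_ordSet_of_isQuadraticTransformAlong_self S' O hdomS' hstepS'
    refine ⟨S', hRS'', hregS', ?_, ?_, ?_⟩
    · exact le_antisymm (ringKrullDim_le_two_of_trdeg htr S') (hdim2 N' hN'N)
    · intro hTS'
      exact hTmin N' hN'N (fun z hz => hTS' hz)
    · rw [← hOS']
      intro t ht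
      exact ⟨hTO ht, fun hinv => hdomT t ht hinv⟩
  -- `S_N` two-dimensional: Zariski's Main Theorem for `T ≤ S_N`
  have hN2 : (2 : WithBot ℕ∞) ≤ ringKrullDim ↥(seq N) := by
    haveI := hregi N
    exact RuledResiduesRegularModelRuled.two_le_ringKrullDim_of_not_le_one hdimN
  have hRSN : R.toSubring ≤ seq N := hmono (Nat.zero_le N)
  let SN : Subalgebra k K :=
    { (seq N).toSubsemiring with algebraMap_mem' := fun c => hRSN (R.algebraMap_mem c) }
  have hRSN' : R ≤ SN := fun z hz => hRSN hz
  haveI hregSN : IsRegularLocalRing ↥SN := hregi N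
  haveI : IsFractionRing ↥SN K := isFractionRing_subalgebra_of_le R SN hRSN'
  haveI : IsIntegrallyClosed ↥SN := isIntegrallyClosed_of_isRegularLocalRing ↥SN
  have hTSN : T ≤ SN := fun z hz => hTN hz
  have hSNO : SN.toSubring ≤ O.toSubring := (hdomO N).1
  have hdimSN : ringKrullDim ↥SN = 2 := le_antisymm (ringKrullDim_le_two_of_trdeg htr SN) hN2
  -- a non-zero element of `𝔪_R`; non-units of `R` are non-units of `T`
  have hnuT : ∀ r : ↥R, r ∈ maximalIdeal ↥R → (r : K) ≠ 0 → ((r : K))⁻¹ ∉ T := by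
    intro r hr hr0 hinv
    have hinvR : ((r : K))⁻¹ ∈ R := hRO.2 _ r.2 (hTO hinv)
    exact (IsLocalRing.mem_maximalIdeal _).mp hr
      ((isUnit_subring_iff_inv_mem (R := R.toSubring) r).mpr ⟨hr0, hinvR⟩)
  obtain ⟨r₀, hr₀m, hr₀0⟩ : ∃ r : ↥R, r ∈ maximalIdeal ↥R ∧ r ≠ 0 := by
    by_contra h
    apply hnf
    rw [IsLocalRing.isField_iff_maximalIdeal_eq, eq_bot_iff]
    intro r hr
    by_contra hr0
    exact h ⟨r, hr, fun h0 => hr0 (by rw [h0]; exact (Ideal.mem_bot).mpr rfl)⟩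
  have hr₀K : (r₀ : K) ≠ 0 := fun h => hr₀0 (Subtype.ext h)
  -- the `T`-algebra structure on `S_N`
  letI algTSN : Algebra ↥T ↥SN := (Subalgebra.inclusion hTSN).toRingHom.toAlgebra
  have halgmap : ∀ t : ↥T, ((algebraMap ↥T ↥SN t : ↥SN) : K) = (t : K) := fun _ => rfl
  haveI : IsScalarTower ↥T ↥SN K := IsScalarTower.of_algebraMap_eq fun _ => rfl
  -- `T → S_N` is local
  haveI : IsLocalHom (algebraMap ↥T ↥SN) := by
    refine ⟨fun t ht => ?_⟩
    have ht0 : ((algebraMap ↥T ↥SN t : ↥SN) : K) ≠ 0 := by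
      intro h; exact ht.ne_zero (Subtype.ext h)
    have hinvSN : (((algebraMap ↥T ↥SN t : ↥SN) : K))⁻¹ ∈ SN := inv_mem_of_isUnit ht
    rw [halgmap] at ht0 hinvSN
    exact isUnit_of_inv_mem ht0 (hdomT _ t.2 (hSNO hinvSN))
  -- `S_N` is essentially of finite type over `T`
  haveI : Algebra.EssFiniteType ↥T ↥SN := by
    obtain ⟨G, hG, hpres⟩ := exists_finset_presentation_of_sequence O seq hstep N
    rw [Algebra.essFiniteType_iff]
    let σ : Finset ↥SN :=
      G.attach.image fun g : {x // x ∈ G} => (⟨g.1, hG (Finset.mem_coe.mpr g.2)⟩ : ↥SN)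
    refine ⟨σ, fun s => ?_⟩
    have hrep : ∀ z ∈ Subring.closure ((seq 0 : Set K) ∪ ↑G),
        ∃ w ∈ Algebra.adjoin ↥T (σ : Set ↥SN), (w : K) = z := by
      intro z hz
      induction hz using Subring.closure_induction with
      | mem z hz =>
        rcases hz with hz | hz
        · exact ⟨algebraMap ↥T ↥SN ⟨z, hRT hz⟩, Subalgebra.algebraMap_mem _ _, rfl⟩
        · refine ⟨⟨z, hG hz⟩, Algebra.subset_adjoin ?_, rfl⟩
          refine Finset.mem_coe.mpr (Finset.mem_image.mpr ?_)
          exact ⟨⟨z, Finset.mem_coe.mp hz⟩, Finset.mem_attach _ _, rfl⟩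
      | zero => exact ⟨0, Subalgebra.zero_mem _, rfl⟩
      | one => exact ⟨1, Subalgebra.one_mem _, rfl⟩
      | add x y _ _ hx hy =>
        obtain ⟨w, hw, rfl⟩ := hx
        obtain ⟨w', hw', rfl⟩ := hy
        exact ⟨w + w', Subalgebra.add_mem _ hw hw', rfl⟩
      | neg x _ hx =>
        obtain ⟨w, hw, rfl⟩ := hx
        exact ⟨-w, Subalgebra.neg_mem _ hw, rfl⟩
      | mul x y _ _ hx hy =>
        obtain ⟨w, hw, rfl⟩ := hx
        obtain ⟨w', hw', rfl⟩ := hy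
        exact ⟨w * w', Subalgebra.mul_mem _ hw hw', rfl⟩
    obtain ⟨a, ha, b, hb, hvb, hs⟩ := hpres (s : K) s.2
    obtain ⟨wa, hwa, hwaK⟩ := hrep a ha
    obtain ⟨wb, hwb, hwbK⟩ := hrep b hb
    have hb0 : b ≠ 0 := ne_zero_of_valuation_eq_one hvb
    have hbinvO : b⁻¹ ∈ O := by
      rw [← O.valuation_le_one_iff, map_inv₀, hvb, inv_one]
    have hbinvSN : b⁻¹ ∈ SN := (hdomO N).2 b (by rw [← hwbK]; exact wb.2) hbinvO
    refine ⟨wb, hwb, ?_, ?_⟩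
    · exact isUnit_of_inv_mem (by rw [hwbK]; exact hb0) (by rw [hwbK]; exact hbinvSN)
    · have : s * wb = wa := by
        apply Subtype.ext
        rw [Subalgebra.coe_mul, hwaK, hwbK, hs, mul_assoc, inv_mul_cancel₀ hb0, mul_one]
      rw [this]; exact hwa
  -- the residue field of `S_N` is algebraic over `k` (`S_N` is two-dimensional), whence `halg`
  have hdiv : ∀ y ∈ SN, ∀ u ∈ SN, O.valuation u = 1 → y * u⁻¹ ∈ SN := by
    intro y hy u hu hvu
    have huinv : u⁻¹ ∈ O := by rw [← O.valuation_le_one_iff, map_inv₀, hvu, inv_one]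
    exact SN.mul_mem hy ((hdomO N).2 u hu huinv)
  have halg : ∀ x : ↥SN, ∃ q : (↥T)[X], (∃ i, q.coeff i ∉ maximalIdeal ↥T) ∧
      q.eval₂ (algebraMap ↥T ↥SN) x ∈ maximalIdeal ↥SN := by
    intro x
    have hx : ¬ ∀ q : k[X], q ≠ 0 → O.valuation (aeval (x : K) q) = 1 := fun h =>
      Lipman1978ValuativeQuadraticSequence.not_mem_of_residuallyTranscendental (O := O) htr SN hN2
        hdiv h x.2
    obtain ⟨q, hq0, hqv⟩ : ∃ q : k[X], q ≠ 0 ∧ O.valuation (aeval (x : K) q) ≠ 1 := by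
      by_contra h
      apply hx
      intro q hq
      by_contra hv
      exact h ⟨q, hq, hv⟩
    obtain ⟨i, hi⟩ : ∃ i, q.coeff i ≠ 0 := by
      by_contra h
      apply hq0
      ext i
      rw [coeff_zero]
      by_contra hci
      exact h ⟨i, hci⟩
    refine ⟨q.map (algebraMap k ↥T), ⟨i, ?_⟩, ?_⟩
    · rw [coeff_map]
      exact fun hm => (IsLocalRing.mem_maximalIdeal _).mp hm
        ((IsUnit.mk0 _ hi).map (algebraMap k ↥T))
    · have hev : (q.map (algebraMap k ↥T)).eval₂ (algebraMap ↥T ↥SN) x = aeval x q := by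
        rw [eval₂_map, ← IsScalarTower.algebraMap_eq, aeval_def]
      rw [hev, IsLocalRing.mem_maximalIdeal, mem_nonunits_iff]
      intro hu
      have hmemK : ((aeval x q : ↥SN) : K) = aeval (x : K) q := (Subalgebra.aeval_coe SN x q).symm
      have hmemSN : aeval (x : K) q ∈ SN := by rw [← hmemK]; exact (aeval x q).2
      have hinv : (aeval (x : K) q)⁻¹ ∈ SN := by rw [← hmemK]; exact inv_mem_of_isUnit hu
      have hne : aeval (x : K) q ≠ 0 := by rw [← hmemK]; exact fun h0 => hu.ne_zero (Subtype.ext h0)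
      exact hqv (SyzygyFlattening.valuation_eq_one_of_inv_mem O (hSNO hmemSN) (hSNO hinv) hne)
  have hSK : Function.Injective (algebraMap ↥SN K) := Subtype.val_injective
  -- the dichotomy
  by_cases hrad : ∀ P : Ideal ↥SN, P.IsPrime →
      (maximalIdeal ↥T).map (algebraMap ↥T ↥SN) ≤ P → P = maximalIdeal ↥SN
  · -- Zariski's Main Theorem: `T = S_N` is regular
    left
    have hbij := bijective_algebraMap_of_essFiniteType_of_forall_isPrime (N := ↥T) (S := ↥SN)
      (K := K) hSK hrad halg
    have hSNT : SN ≤ T := by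
      intro z hz
      obtain ⟨t, ht⟩ := hbij.2 ⟨z, hz⟩
      have h : (t : K) = z := congrArg (fun w : ↥SN => (w : K)) ht
      rw [← h]; exact t.2
    have hTeq : T = SN := le_antisymm hTSN hSNT
    rw [hTeq]; exact hregSN
  · -- an exceptional prime divisor `(S_N)_P` ⇒ a base point
    right
    obtain ⟨P, hP, hmP, hPne⟩ : ∃ P : Ideal ↥SN, P.IsPrime ∧
        (maximalIdeal ↥T).map (algebraMap ↥T ↥SN) ≤ P ∧ P ≠ maximalIdeal ↥SN := by
      by_contra h
      apply hrad
      intro P hP hle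
      by_contra hne
      exact h ⟨P, hP, hle, hne⟩
    haveI := hP
    have hPle : P ≤ maximalIdeal ↥SN := IsLocalRing.le_maximalIdeal hP.ne_top
    have hPlt : P < maximalIdeal ↥SN := lt_of_le_of_ne hPle hPne
    -- `P ≠ 0`
    have hr₀T : (⟨(r₀ : K), hRT r₀.2⟩ : ↥T) ∈ maximalIdeal ↥T := by
      rw [IsLocalRing.mem_maximalIdeal, mem_nonunits_iff]
      intro hu
      exact hnuT r₀ hr₀m hr₀K (inv_mem_of_isUnit hu)
    have hr₀P : algebraMap ↥T ↥SN ⟨(r₀ : K), hRT r₀.2⟩ ∈ P := hmP (Ideal.mem_map_of_mem _ hr₀T)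
    have hPbot : P ≠ ⊥ := fun h => by
      rw [h, Ideal.mem_bot] at hr₀P
      have h' := congrArg (fun w : ↥SN => (w : K)) hr₀P
      rw [halgmap] at h'
      exact hr₀K h'
    -- `ht P = 1`
    have hP1 : P.height = 1 := by
      have h1 : P.height + 1 ≤ (maximalIdeal ↥SN).height :=
        Ideal.height_add_one_le_of_lt_of_isPrime hPlt
      have h2 : ((maximalIdeal ↥SN).height : WithBot ℕ∞) ≤ ringKrullDim ↥SN :=
        Ideal.height_le_ringKrullDim_of_isPrime
      rw [hdimSN, show (2 : WithBot ℕ∞) = ((2 : ℕ∞) : WithBot ℕ∞) from rfl] at h2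
      have h3 : (maximalIdeal ↥SN).height ≤ 2 := WithBot.coe_le_coe.mp h2
      have h4 : P.height ≠ 0 := fun h0 => hPbot (Ideal.height_eq_zero_iff_eq_bot.mp h0)
      have h5 : P.height + 1 ≤ 2 := h1.trans h3
      rcases ENat.ne_top_iff_exists.mp (show P.height ≠ ⊤ from by
        intro htop; rw [htop, top_add] at h5; exact absurd h5 (by decide)) with ⟨c, hc⟩
      rw [← hc] at h4 h5 ⊢
      have h6 : c + 1 ≤ 2 := by exact_mod_cast h5
      have h7 : c ≠ 0 := fun h0 => h4 (by rw [h0]; rfl)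
      exact_mod_cast (show c = 1 by omega)
    haveI hdvr : IsDiscreteValuationRing (Localization.AtPrime P) :=
      isDiscreteValuationRing_localization_of_height_eq_one P hP1
    let W : ValuationSubring K := placeOfPrime SN P inferInstance
    haveI : IsDiscreteValuationRing ↥W := isDiscreteValuationRing_placeOfPrime_of_localization SN P
    have hSNW : SN.toSubring ≤ W.toSubring := le_placeOfPrime SN P _
    have hWnu : ∀ s : ↥SN, (s : K) ∈ W.nonunits ↔ s ∈ P :=
      coe_mem_nonunits_placeOfPrime_iff SN P inferInstance
    have hunitW : ∀ s : ↥SN, s ∉ P → ((s : K))⁻¹ ∈ W := by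
      intro s hs
      have h := (not_congr (hWnu s)).mpr hs
      rw [ValuationSubring.mem_nonunits_iff_or, not_or, not_not] at h
      exact h.2
    have hmemP_of : ∀ t : K, ∀ ht : t ∈ T, (⟨t, ht⟩ : ↥T) ∈ maximalIdeal ↥T →
        W.valuation t < 1 := by
      intro t ht htm
      have htP : algebraMap ↥T ↥SN ⟨t, ht⟩ ∈ P := hmP (Ideal.mem_map_of_mem _ htm)
      have hnu := (hWnu _).mpr htP
      rw [ValuationSubring.mem_nonunits_iff] at hnu
      exact hnu
    -- `W` dominates `T` and `R`
    have hWT : ∀ t : K, t ∈ T → t⁻¹ ∈ W → t⁻¹ ∈ T := by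
      intro t ht hinv
      by_cases ht0 : t = 0
      · rw [ht0, inv_zero]; exact T.zero_mem
      by_contra hninT
      have htm : (⟨t, ht⟩ : ↥T) ∈ maximalIdeal ↥T := by
        rw [IsLocalRing.mem_maximalIdeal, mem_nonunits_iff]
        exact fun hu => hninT (inv_mem_of_isUnit hu)
      have h1 := SyzygyFlattening.valuation_eq_one_of_inv_mem W (hSNW (hTN ht)) hinv ht0
      exact absurd h1 (hmemP_of t ht htm).ne
    have hWR : SubringDominates R.toSubring W.toSubring := by
      refine ⟨fun z hz => hSNW (hRSN hz), fun r hr hinv => ?_⟩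
      by_cases hr0 : r = 0
      · rw [hr0, inv_zero]; exact R.zero_mem
      have hinvT : r⁻¹ ∈ T := hWT r (hRT hr) hinv
      exact hRO.2 r hr (hTO hinvT)
    -- `W` does not dominate `S_N`
    have hWN : ¬ SubringDominates (seq N) W.toSubring := by
      intro hdom
      obtain ⟨s, hsm, hsP⟩ := SetLike.exists_of_lt hPlt
      have hs0 : (s : K) ≠ 0 := fun h =>
        hsP (by rw [show s = 0 from Subtype.ext h]; exact P.zero_mem)
      have hinvW : ((s : K))⁻¹ ∈ W := hunitW s hsP
      have hinvSN : ((s : K))⁻¹ ∈ seq N := hdom.2 _ s.2 hinvW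
      exact (IsLocalRing.mem_maximalIdeal _).mp hsm (isUnit_of_inv_mem hs0 hinvSN)
    exact basePts_nonempty_of_exceptional_divisor htr hdimR O hRO T N hTN hTmin hN2 W hSNW hWR
      hWT hWN

end Summit.ResolutionOfSingularities.ResolutionOfSingularities.Theorems.NoZeno.SandwichCluster

end
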